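import Mathlib
import HarnessLib
import Literature.Analysis.FluidPDE.SuitableWeak
import Literature.Analysis.FluidPDE.SelfSimilar
import Literature.Analysis.FluidPDE.LocalTypeI
import Literature.Analysis.FluidPDE.NSBoundedMildOseen
import Literature.Analysis.FluidPDE.SlabTypeICompactness
import Literature.Analysis.FluidPDE.TypeIRateOseenMildRepresentative
import Literature.Analysis.FluidPDE.LocalTypeIReverseZoom
import Literature.Analysis.FluidPDE.LocalTypeICongr
import Summits.NavierStokesRegularity.NavierStokesRegularity.Theorems.RellichScarApexLocalisationApexOfDecaying
import Summits.NavierStokesRegularity.NavierStokesRegularity.Theorems.RellichScarApexLocalisationRateToAncient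
import Summits.NavierStokesRegularity.NavierStokesRegularity.Theorems.ApexLocalisation.Negative.BridgeBetOptimality

/-!
# `RellichScar.ApexLocalisation` ⇔ its mild-side ∃-form (line decaying-ancient-bridge, lead's certificate)

Crux `Summit.NavierStokesRegularity.NavierStokesRegularity.Theses.RellichScar.ApexLocalisation`
(stmt-NavierStokesRegularity-11719). With the five LANDED stubs of line decaying-ancient-bridge the crux
is moved to the MILD side as an EQUIVALENT existence-upgrade statement about the class 𝒜(C,B)
(`…Negative.InBridgeClass C B M`: bounded by `B`, continuous, Oseen-mild ancient solutions on
`(-∞,0) × ℝ³` with the Type-I rate `C/√(-t)` and suitable-weak data with Albritton–Barker `𝐈 < ⊤`):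

  `ApexLocalisation ↔ (𝒜 has a non-trivial member → 𝒜 has a non-trivial member with ‖y‖ ‖M(s,y)‖ ≤ K)`

(`apexLocalisation_iff_mildDecayingMember`). The registered bet `stub_hullSelection` (∀-form: EVERY
non-trivial member has such a HULL LIMIT) implies the right-hand side via `stub_hullClosed`; the
∃-form proved equivalent here is exactly as strong as the crux (KNSS 2009 (1.4) ⇒ (1.6) at the level
of existence; Seregin 2014 Prop 5.19 is the axisymmetric same-solution instance).

Ingredients: `slab_typeI_compactness` (engine, Literature), `stub_rateToAncient` (⇒ transfer),
`stub_apexOfDecaying` (⇐ transfer), the glue (the refuters' verbatim twins `shiftedDecay_of_bounds'`,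
`not_ae_eq_zero_of_continuousOn_slab`), the refuters' `classGivesRateProfile_of_slabEngine`
(blow-down of a non-trivial class member, modulo the engine — discharged here: `slabEngine_holds`), and
one new construction `exists_inBridgeClass_shift_of_majorant`: the continuous Oseen-mild representative
of a rate-Type-I slab profile with `𝐈 < ⊤` (`exists_oseenMild_repr_of_typeIBound_lt_top`, KNSS L3.1 +
A–B), shifted into the past by `δ`, is a non-trivial class member inheriting ANY continuous pointwise
majorant of the profile (a.e. → everywhere by continuity on the open slab).
-/

-- the summit and its single sub-problem share the name (CONVENTIONS §1), as in every Theorems file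
set_option linter.dupNamespace false

namespace Summit.NavierStokesRegularity.NavierStokesRegularity.Theorems.RellichScarApexLocalisation

open MeasureTheory Set Function Metric Filter Topology TopologicalSpace
open scoped ENNReal NNReal
open Literature.Analysis Literature.Analysis.FluidPDE
open Summit.NavierStokesRegularity.NavierStokesRegularity.Theorems.ApexLocalisation.Negative
open Summit.NavierStokesRegularity.NavierStokesRegularity.Theses

/-! ### The engine, discharged for the refuters' named form -/

/-- The refuters' named engine `SlabEngine` (verbatim `stub_slabCompactness`) HOLDS: it is the
Literature theorem `slab_typeI_compactness` (Albritton–Barker 2019 Lemma 2.2 + Prop 2.3 on the slab). -/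
theorem slabEngine_holds : SlabEngine := slab_typeI_compactness

/-! ### a.e. majorants of continuous fields hold everywhere -/

/-- On the open slab, an a.e. inequality `‖v‖ ≤ g` between a continuous field and a continuous
majorant holds everywhere (the strict super-level set is open and null, hence empty). -/
theorem norm_le_of_ae_of_continuousOn {v : ℝ → EuclideanSpace ℝ (Fin 3) → EuclideanSpace ℝ (Fin 3)}
    {g : ℝ × EuclideanSpace ℝ (Fin 3) → ℝ}
    (hv : ContinuousOn (uncurry v) (Iio (0 : ℝ) ×ˢ univ))
    (hg : ContinuousOn g (Iio (0 : ℝ) ×ˢ univ))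
    (hae : ∀ᵐ w ∂(volume.restrict (Iio (0 : ℝ) ×ˢ (univ : Set (EuclideanSpace ℝ (Fin 3))))),
      ‖uncurry v w‖ ≤ g w) :
    ∀ t : ℝ, t < 0 → ∀ x : EuclideanSpace ℝ (Fin 3), ‖v t x‖ ≤ g (t, x) := by
  intro t ht x
  by_contra hlt
  push Not at hlt
  set S : Set (ℝ × EuclideanSpace ℝ (Fin 3)) := Iio (0 : ℝ) ×ˢ univ with hS
  have hSopen : IsOpen S := isOpen_Iio.prod isOpen_univ
  -- the strict super-level set is open in the open slab
  have hF : ContinuousOn (fun w => (g w, ‖uncurry v w‖)) S := hg.prodMk hv.norm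
  have hUopen : IsOpen (S ∩ (fun w => (g w, ‖uncurry v w‖)) ⁻¹' {q : ℝ × ℝ | q.1 < q.2}) :=
    hF.isOpen_inter_preimage hSopen (isOpen_lt continuous_fst continuous_snd)
  have hmem : ((t, x) : ℝ × EuclideanSpace ℝ (Fin 3)) ∈
      S ∩ (fun w => (g w, ‖uncurry v w‖)) ⁻¹' {q : ℝ × ℝ | q.1 < q.2} :=
    ⟨⟨ht, mem_univ _⟩, hlt⟩
  have hpos : 0 < volume (S ∩ (fun w => (g w, ‖uncurry v w‖)) ⁻¹' {q : ℝ × ℝ | q.1 < q.2}) :=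
    hUopen.measure_pos volume ⟨(t, x), hmem⟩
  -- … and null
  have hzero : volume.restrict S ((fun w => (g w, ‖uncurry v w‖)) ⁻¹' {q : ℝ × ℝ | q.1 < q.2}) = 0 := by
    refine measure_eq_zero_iff_ae_notMem.2 ?_
    filter_upwards [hae] with w hw
    simp only [mem_preimage, mem_setOf_eq, not_lt]
    exact hw
  rw [Measure.restrict_apply' hSopen.measurableSet, inter_comm] at hzero
  exact hpos.ne' hzero

/-! ### Two slab bookkeeping lemmas (as in `…RateToAncient`, where they are private) -/

/-- The backward slab lies in its own pull-back under a past shift / unit-scale zoom (`t₀ ≤ 0`):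
`t < 0 ⟹ t₀ + λ² t < 0`. -/
theorem slab_le_stPreimage_shift' {t₀ : ℝ} (ht₀ : t₀ ≤ 0) {lam : ℝ} (hl0 : 0 < lam)
    (x₀ : EuclideanSpace ℝ (Fin 3)) :
    (slab (EuclideanSpace ℝ (Fin 3)) (Iio 0) isOpen_Iio) ≤
      stPreimage (lam ^ 2) lam t₀ x₀ (slab (EuclideanSpace ℝ (Fin 3)) (Iio 0) isOpen_Iio) := by
  intro w hw
  have hw' : w.1 < 0 := by simpa [mem_slab] using hw
  show stAffine (lam ^ 2) lam t₀ x₀ w ∈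
    (slab (EuclideanSpace ℝ (Fin 3)) (Iio 0) isOpen_Iio : Opens (ℝ × EuclideanSpace ℝ (Fin 3)))
  rw [mem_slab, stAffine_fst]
  show t₀ + lam ^ 2 * w.1 < 0
  nlinarith [mul_neg_of_pos_of_neg (pow_pos hl0 2) hw']

/-- A parabolic ball inside the backward slab has a non-positive top time: otherwise
`(z.1 − ε, z.2) ∈ Q(z, r)` has positive time for small `ε > 0`. -/
theorem fst_nonpos_of_parabolicCylinder_subset_slab' {r : ℝ} (hr : 0 < r)
    {z : ℝ × EuclideanSpace ℝ (Fin 3)}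
    (h : parabolicCylinder r z ⊆ Iio (0 : ℝ) ×ˢ (univ : Set (EuclideanSpace ℝ (Fin 3)))) : z.1 ≤ 0 := by
  by_contra hz
  push Not at hz
  have hε1 : min (r ^ 2 / 2) (z.1 / 2) ≤ r ^ 2 / 2 := min_le_left _ _
  have hε2 : min (r ^ 2 / 2) (z.1 / 2) ≤ z.1 / 2 := min_le_right _ _
  have hε0 : 0 < min (r ^ 2 / 2) (z.1 / 2) := lt_min (by positivity) (by linarith)
  have hw : (z.1 - min (r ^ 2 / 2) (z.1 / 2), z.2) ∈ parabolicCylinder r z := by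
    rw [mem_parabolicCylinder]
    exact ⟨⟨by dsimp only; nlinarith [sq_nonneg r], by dsimp only; linarith⟩, by simpa using hr⟩
  have : z.1 - min (r ^ 2 / 2) (z.1 / 2) < 0 := (h hw).1
  linarith

/-! ### The shifted Oseen-mild representative of a rate profile is a class member -/

/-- **The δ-shifted continuous Oseen-mild representative of a rate-Type-I singular slab profile with
`𝐈 < ⊤` is a NON-trivial member of the class 𝒜(C, C/√δ), and it inherits every continuous pointwise
majorant `g` of the profile, shifted** (construction of `stub_rateToAncient`, with the majorant added):
`M(t,x) = v(t - δ, x)` where `v` is the representative of `exists_oseenMild_repr_of_typeIBound_lt_top`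
and `δ = -t₀/2` for a point `(t₀, y₀)` of the slab with `v(t₀, y₀) ≠ 0`. -/
theorem exists_inBridgeClass_shift_of_majorant {C : ℝ}
    {u : ℝ → EuclideanSpace ℝ (Fin 3) → EuclideanSpace ℝ (Fin 3)} {p : ℝ → EuclideanSpace ℝ (Fin 3) → ℝ}
    {G : ℝ → EuclideanSpace ℝ (Fin 3) → EuclideanSpace ℝ (Fin 3) →L[ℝ] EuclideanSpace ℝ (Fin 3)}
    (hsws : IsSuitableWeakSolutionOn (slab (EuclideanSpace ℝ (Fin 3)) (Iio 0) isOpen_Iio) 1 0 u p)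
    (hgrad : HasWeakSpatialGradientOn (slab (EuclideanSpace ℝ (Fin 3)) (Iio 0) isOpen_Iio) u G)
    (hI : typeIBound (Iio (0 : ℝ) ×ˢ univ) u p G < ⊤) (hC : HasTypeITimeDecay C u)
    (hsing : IsBackwardSingularPoint u 0)
    {g : ℝ × EuclideanSpace ℝ (Fin 3) → ℝ} (hg : ContinuousOn g (Iio (0 : ℝ) ×ˢ univ))
    (hug : ∀ t : ℝ, t < 0 → ∀ x : EuclideanSpace ℝ (Fin 3), ‖u t x‖ ≤ g (t, x)) :
    ∃ δ : ℝ, 0 < δ ∧ ∃ M : ℝ → EuclideanSpace ℝ (Fin 3) → EuclideanSpace ℝ (Fin 3),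
      InBridgeClass C (C / Real.sqrt δ) M ∧ (∃ s : ℝ, s < 0 ∧ ∃ y : EuclideanSpace ℝ (Fin 3), M s y ≠ 0) ∧
      ∀ t : ℝ, t < 0 → ∀ x : EuclideanSpace ℝ (Fin 3), ‖M t x‖ ≤ g (t - δ, x) := by
  -- ## the continuous Oseen-mild representative of `u`
  obtain ⟨v, hae, hvc, hvd, hvm, hvC⟩ := exists_oseenMild_repr_of_typeIBound_lt_top hsws hC hI
  have hC0 : 0 ≤ C := by
    have h := hC (-1) (by norm_num) 0
    rw [neg_neg, Real.sqrt_one, div_one] at h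
    exact (norm_nonneg _).trans h
  have hae' : ∀ᵐ w ∂(volume.restrict ((slab (EuclideanSpace ℝ (Fin 3)) (Iio 0) isOpen_Iio :
      Opens (ℝ × EuclideanSpace ℝ (Fin 3))) : Set (ℝ × EuclideanSpace ℝ (Fin 3)))),
      uncurry u w = uncurry v w := by
    rw [coe_slab]
    exact hae
  have hsws_v : IsSuitableWeakSolutionOn (slab (EuclideanSpace ℝ (Fin 3)) (Iio 0) isOpen_Iio) 1 0 v p :=
    hsws.congr_ae hae' (ae_of_all _ fun _ => rfl)
  have hgrad_v : HasWeakSpatialGradientOn (slab (EuclideanSpace ℝ (Fin 3)) (Iio 0) isOpen_Iio) v G :=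
    hgrad.congr_ae hae'
  have hI_v : typeIBound (Iio (0 : ℝ) ×ˢ univ) v p G < ⊤ := by
    rwa [← typeIBound_congr_ae hae]
  have hsing_v : IsBackwardSingularPoint v 0 :=
    hsing.congr_ae (fun r _ => parabolicCylinder_origin_subset_slab r) hae
  -- the majorant passes to `v` everywhere
  have hvg : ∀ t : ℝ, t < 0 → ∀ x : EuclideanSpace ℝ (Fin 3), ‖v t x‖ ≤ g (t, x) := by
    refine norm_le_of_ae_of_continuousOn hvc hg ?_
    have hall : ∀ᵐ w ∂(volume.restrict (Iio (0 : ℝ) ×ˢ (univ : Set (EuclideanSpace ℝ (Fin 3))))),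
        w ∈ Iio (0 : ℝ) ×ˢ (univ : Set (EuclideanSpace ℝ (Fin 3))) :=
      ae_restrict_mem (isOpen_Iio.prod isOpen_univ).measurableSet
    filter_upwards [hae, hall] with w hw hwS
    rw [← hw]
    exact hug w.1 (mem_Iio.1 hwS.1) w.2
  -- ## a point of negative time where `v ≠ 0`, and the shift `δ = −t₀/2`
  obtain ⟨t₀, ht₀, y₀, hy₀⟩ := exists_ne_zero_of_isBackwardSingularPoint hsing_v
  set δ : ℝ := -t₀ / 2 with hδ
  have hδ0 : 0 < δ := by rw [hδ]; linarith
  have hδle : -δ ≤ 0 := by linarith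
  -- ## the past time shift `M(t, x) = v(t − δ, x)`, written as a unit-scale zoom
  set M : ℝ → EuclideanSpace ℝ (Fin 3) → EuclideanSpace ℝ (Fin 3) :=
    (1 : ℝ) • stPull ((1 : ℝ) ^ 2) 1 (-δ) 0 v with hMdef
  have hMap : ∀ t x, M t x = v (t - δ) x := fun t x => by
    rw [hMdef, smul_stPull_apply, one_smul, one_pow, one_mul, one_smul, zero_add, neg_add_eq_sub]
  have hMfun : M = fun t x => v (t - δ) x := funext fun t => funext fun x => hMap t x
  have hpre : slab (EuclideanSpace ℝ (Fin 3)) (Iio 0) isOpen_Iio ≤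
      stPreimage ((1 : ℝ) ^ 2) 1 (-δ) (0 : EuclideanSpace ℝ (Fin 3))
        (slab (EuclideanSpace ℝ (Fin 3)) (Iio 0) isOpen_Iio) :=
    slab_le_stPreimage_shift' hδle one_pos 0
  refine ⟨δ, hδ0, M, ⟨?_, ?_, ?_, ?_, ?_, ?_⟩, ?_, ?_⟩
  · -- continuity on the open slab
    rw [hMfun]
    refine hvc.comp (f := fun q : ℝ × EuclideanSpace ℝ (Fin 3) => (q.1 - δ, q.2))
      ((continuous_fst.sub continuous_const).prodMk continuous_snd).continuousOn ?_
    intro q hq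
    exact ⟨show q.1 - δ < 0 by have := mem_Iio.1 hq.1; linarith, mem_univ _⟩
  · -- weakly divergence-free slices
    intro t ht
    rw [hMfun]
    exact hvd (t - δ) (by linarith)
  · -- the Oseen identity (time translation covariance)
    intro s t hst ht x
    have h1 := hvm (s - δ) (t - δ) (by linarith) (by linarith) x
    rw [show t - δ - (s - δ) = t - s by ring] at h1
    rw [hMfun]
    show v (t - δ) x = UnboundedOperators.heatExtension (v (s - δ)) (t - s) x -
      oseenDuhamel 1 s (fun τ => v (τ - δ)) (fun τ => v (τ - δ)) t x
    rw [oseenDuhamel_comp_sub_right]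
    exact h1
  · -- the bound `B = C/√δ`
    intro t ht x
    rw [hMap]
    exact (hvC (t - δ) (by linarith) x).trans
      (div_le_div_of_nonneg_left hC0 (Real.sqrt_pos.2 hδ0) (Real.sqrt_le_sqrt (by linarith)))
  · -- the rate, with the same constant
    intro t ht x
    rw [hMap]
    exact (hvC (t - δ) (by linarith) x).trans
      (div_le_div_of_nonneg_left hC0 (Real.sqrt_pos.2 (neg_pos.2 ht)) (Real.sqrt_le_sqrt (by linarith)))
  · -- suitable-weak data with `𝐈 < ⊤`: the time-shifted triple
    refine ⟨((1 : ℝ) ^ 2) • stPull ((1 : ℝ) ^ 2) 1 (-δ) 0 p,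
      ((1 : ℝ) ^ 2) • stPull ((1 : ℝ) ^ 2) 1 (-δ) 0 G, ?_, ?_, ?_⟩
    · exact (zoom_isSuitableWeakSolutionOn hsws_v one_pos (-δ) 0).of_le hpre
    · exact (zoom_hasWeakSpatialGradientOn hgrad_v one_pos (-δ) 0).mono hpre
    · refine lt_of_le_of_lt (typeIBound_le_iff.2 fun r hr z hz => ?_) hI_v
      exact abScaledSum_zoom_le_typeIBound one_pos hδle 0 hr
        (fst_nonpos_of_parabolicCylinder_subset_slab' hr hz)
  · -- non-triviality at the negative time `t₀ + δ = t₀/2`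
    refine ⟨t₀ + δ, by rw [hδ]; linarith, y₀, ?_⟩
    rw [hMap, add_sub_cancel_right]
    exact hy₀
  · -- the shifted majorant
    intro t ht x
    rw [hMap]
    exact hvg (t - δ) (by linarith) x

/-! ### The ∃-form of the bet follows from an apex profile -/

/-- **An apex profile yields a non-trivial class member with the KNSS spatial bound** `‖y‖ ‖M‖ ≤ C`:
shift its Oseen-mild representative into the past (`exists_inBridgeClass_shift_of_majorant` with the
apex majorant `C/(‖x‖ + √(-t))`). -/
theorem exists_inBridgeClass_spatialBound_of_apexProfileExists (h : ApexProfileExists) :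
    ∃ (C B : ℝ) (M : ℝ → EuclideanSpace ℝ (Fin 3) → EuclideanSpace ℝ (Fin 3)),
      InBridgeClass C B M ∧ (∃ s : ℝ, s < 0 ∧ ∃ y : EuclideanSpace ℝ (Fin 3), M s y ≠ 0) ∧
      ∃ K : ℝ, ∀ s < 0, ∀ y : EuclideanSpace ℝ (Fin 3), ‖y‖ * ‖M s y‖ ≤ K := by
  obtain ⟨C, u, p, G, hsws, hgrad, hI, hdec, hsing⟩ := h
  have hC0 : 0 ≤ C := nonneg_of_hasTypeIDecay hdec
  have hg : ContinuousOn (fun w : ℝ × EuclideanSpace ℝ (Fin 3) => C / (‖w.2‖ + Real.sqrt (-w.1)))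
      (Iio (0 : ℝ) ×ˢ univ) := by
    refine continuousOn_const.div (by fun_prop) fun w hw => ?_
    have : 0 < Real.sqrt (-w.1) := Real.sqrt_pos.2 (neg_pos.2 (mem_Iio.1 hw.1))
    positivity
  obtain ⟨δ, hδ0, M, hM, hnt, hmaj⟩ := exists_inBridgeClass_shift_of_majorant hsws hgrad hI
    (hdec.hasTypeITimeDecay hC0) hsing hg (fun t ht x => hdec t ht x)
  refine ⟨C, C / Real.sqrt δ, M, hM, hnt, C, fun s hs y => ?_⟩
  have h := hmaj s hs y
  simp only at h
  have hsq : 0 < Real.sqrt (-(s - δ)) := Real.sqrt_pos.2 (by linarith)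
  have hden : 0 < ‖y‖ + Real.sqrt (-(s - δ)) := by positivity
  calc ‖y‖ * ‖M s y‖ ≤ ‖y‖ * (C / (‖y‖ + Real.sqrt (-(s - δ)))) :=
        mul_le_mul_of_nonneg_left h (norm_nonneg _)
    _ = C * (‖y‖ / (‖y‖ + Real.sqrt (-(s - δ)))) := by ring
    _ ≤ C * 1 := by
        refine mul_le_mul_of_nonneg_left ?_ hC0
        rw [div_le_one hden]
        linarith [hsq.le]
    _ = C := mul_one C

/-! ### The equivalence -/

/-- **Crux ⇔ mild ∃-form.** `RellichScar.ApexLocalisation` holds iff: whenever the class 𝒜 has a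
non-trivial member, it has a non-trivial member with the KNSS spatial bound `‖y‖ ‖M(s,y)‖ ≤ K`.
(⇒) blow a non-trivial member down to a rate profile (`classGivesRateProfile_of_slabEngine`,
engine discharged), localise it by the crux, and shift the apex profile's Oseen-mild representative
into the past; (⇐) `stub_rateToAncient`, the hypothesis, the glue, and `stub_apexOfDecaying`. -/
theorem apexLocalisation_iff_mildDecayingMember :
    RellichScar.ApexLocalisation ↔
      ((∃ (C B : ℝ) (M : ℝ → EuclideanSpace ℝ (Fin 3) → EuclideanSpace ℝ (Fin 3)),
          InBridgeClass C B M ∧ ∃ s : ℝ, s < 0 ∧ ∃ y : EuclideanSpace ℝ (Fin 3), M s y ≠ 0) →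
        ∃ (C B : ℝ) (M : ℝ → EuclideanSpace ℝ (Fin 3) → EuclideanSpace ℝ (Fin 3)),
          InBridgeClass C B M ∧ (∃ s : ℝ, s < 0 ∧ ∃ y : EuclideanSpace ℝ (Fin 3), M s y ≠ 0) ∧
          ∃ K : ℝ, ∀ s < 0, ∀ y : EuclideanSpace ℝ (Fin 3), ‖y‖ * ‖M s y‖ ≤ K) := by
  constructor
  · rintro hcrux ⟨C, B, M, hM, hnt⟩
    have hrate : RateProfileExists := classGivesRateProfile_of_slabEngine slabEngine_holds C B M hM hnt
    obtain ⟨C₁, u, p, G, h1, h2, h3, h4, h5⟩ := hrate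
    obtain ⟨C', u', p', G', h1', h2', h3', h4', h5'⟩ := hcrux C₁ ⟨u, p, G, h1, h2, h3, h4, h5⟩
    exact exists_inBridgeClass_spatialBound_of_apexProfileExists ⟨C', u', p', G', h1', h2', h3', h4', h5'⟩
  · intro himp C hRate
    obtain ⟨B, M, hM, hMnt⟩ := stub_rateToAncient slab_typeI_compactness C hRate
    obtain ⟨C', B', N, hN, ⟨s, hs, y, hy⟩, K, hK⟩ := himp ⟨C, B, M, hM, hMnt⟩
    obtain ⟨hNcont, -, -, hNB, hNC, q, H, hsws, hgrad, hI⟩ := hN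
    have hdecay := shiftedDecay_of_bounds' hNB hNC hK
    have hnt := not_ae_eq_zero_of_continuousOn_slab hNcont hs hy
    exact stub_apexOfDecaying slab_typeI_compactness ⟨B' + C' + K, N, q, H, hsws, hgrad, hI, hnt, hdecay⟩

end Summit.NavierStokesRegularity.NavierStokesRegularity.Theorems.RellichScarApexLocalisation
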